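import Mathlib
import Summits.Ventures.PercRepro2.A3InactiveTyped

/-!
# The half-conditioned typed BHK 1.4 is a theorem: `N(Q ∩ A ∩ B, Ω) ≤ N(Q ∩ A, B)`
(blind cell PercRepro2, p5 g2, 2026-08-25; sub-claim S4, `proofs/P5-TB14.md` §1)

Two copies at a profile «`F` free, `z` pinned»: the first copy `y` agrees with `z` off `F`, the
second copy is `flipOn F y` (every free edge open in exactly one copy); `pairCount F z Φ` is the
sum of `Φ y (flipOn F y)` over the admissible `y` (`A3InactiveTyped.pairCount`).

`TB14` (typed BHK 1.4, a CANDIDATE of record, not a theorem) compares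
`N(Q ∩ A ∩ B, Q)` with `N(Q ∩ A, Q ∩ B)`, `Q = {a₁ ↮ a₂}`, `A = {b ∈ C(a₁)}`, `B = {o ∈ C(a₂)}`.
THIS FILE proves, unconditionally, the HALF-CONDITIONED form in which the second copy carries no
`Q`:

  `pairCount_half :  N(Q ∩ A ∩ B, Ω) ≤ N(Q ∩ A, B)`

— «`B` prefers the copy that does not carry `Q ∩ A`». It is the Bernstein-coefficient
(profile-wise) form of the classical bound `P(B | Q ∩ A) ≤ P(B)` (itself a consequence of
van den Berg–Häggström–Kahn 1.4 and Harris), and it is exactly `TB14` on the graphs in which `a₁`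
is a pendant vertex (the pendant root decouples the second copy's `Q`).

PROOF (the «wall / hubs» argument). Let `W = C_y(a₁)` be the red cluster of `a₁` (first copy).
The **wall flip** `wallFlip F y` complements the free edges NOT touching `W`; it is an involution
of the admissible first copies which fixes `W`, hence fixes `1_Q(y)` and `1_A(y)`. Under `Q`,
every open edge of the red cluster of `a₂` is away from `W`, so it is open in the second copy of
the wall-flipped configuration: `C_y(a₂) ⊆ C_{flipOn F (wallFlip F y)}(a₂)` — the wall `∂W` (closed
in the first copy) is a set of open edges (hubs) for the second copy. So
`1_B(y) ≤ 1_B(flipOn F (wallFlip F y))` termwise on `Q`, and re-indexing the sum by the involution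
gives the inequality. No probabilistic input; standard axioms only.
-/

namespace Summit.Ventures.PercRepro2

namespace TypedBHKHalf

open CovForm A3InactiveTyped

section WallFlip

variable {V : Type*} {E : Type*} [DecidableEq E]

open Classical in
/-- **The wall flip**: complement the free edges (`e ∈ F`) that do not touch the cluster of `a₁`
in `y`; the edges touching `C_y(a₁)` (its inside and its boundary — the «wall») are kept. -/
noncomputable def wallFlip (ends : E → Sym2 V) (a₁ : V) (F : Finset E) (y : Config E) :
    Config E :=
  fun e => if e ∈ F ∧ e ∉ touches ends (cluster ends y a₁) then !(y e) else y e

variable (ends : E → Sym2 V) (a₁ : V) (F : Finset E)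

/-- Edges touching the cluster of `a₁` are kept. -/
lemma wallFlip_of_touches {y : Config E} {e : E} (he : e ∈ touches ends (cluster ends y a₁)) :
    wallFlip ends a₁ F y e = y e := by
  unfold wallFlip
  rw [if_neg]
  exact fun h => h.2 he

/-- Pinned edges are kept. -/
lemma wallFlip_of_notMem {y : Config E} {e : E} (he : e ∉ F) : wallFlip ends a₁ F y e = y e := by
  unfold wallFlip
  rw [if_neg]
  exact fun h => he h.1

/-- Free edges away from the cluster of `a₁` are complemented. -/
lemma wallFlip_of_mem {y : Config E} {e : E} (heF : e ∈ F)
    (he : e ∉ touches ends (cluster ends y a₁)) : wallFlip ends a₁ F y e = !(y e) := by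
  unfold wallFlip
  rw [if_pos ⟨heF, he⟩]

/-- Edges not in «free and away from the cluster» are kept. -/
lemma wallFlip_of_not {y : Config E} {e : E}
    (he : ¬ (e ∈ F ∧ e ∉ touches ends (cluster ends y a₁))) : wallFlip ends a₁ F y e = y e := by
  unfold wallFlip
  rw [if_neg he]

/-- The wall flip fixes the cluster of `a₁` (domain Markov: the cluster is determined by the
edges touching it, which are kept). -/
lemma cluster_wallFlip (y : Config E) :
    cluster ends (wallFlip ends a₁ F y) a₁ = cluster ends y a₁ :=
  cluster_eq_of_eqOn_touches (fun _ he => (wallFlip_of_touches ends a₁ F he).symm) rfl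

/-- Connection to `a₁` is unchanged by the wall flip. -/
lemma conn_wallFlip_iff (y : Config E) (v : V) :
    Conn ends (wallFlip ends a₁ F y) a₁ v ↔ Conn ends y a₁ v := by
  have h := cluster_wallFlip ends a₁ F y
  rw [Set.ext_iff] at h
  simpa only [mem_cluster] using h v

/-- The wall flip is an involution. -/
lemma wallFlip_wallFlip (y : Config E) : wallFlip ends a₁ F (wallFlip ends a₁ F y) = y := by
  funext e
  by_cases he : e ∈ F ∧ e ∉ touches ends (cluster ends y a₁)
  · have h1 : wallFlip ends a₁ F y e = !(y e) := wallFlip_of_mem ends a₁ F he.1 he.2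
    have h2 : wallFlip ends a₁ F (wallFlip ends a₁ F y) e = !(wallFlip ends a₁ F y e) := by
      apply wallFlip_of_mem ends a₁ F he.1
      rw [cluster_wallFlip]
      exact he.2
    rw [h2, h1, Bool.not_not]
  · have h1 : wallFlip ends a₁ F y e = y e := wallFlip_of_not ends a₁ F he
    have he' : ¬ (e ∈ F ∧ e ∉ touches ends (cluster ends (wallFlip ends a₁ F y) a₁)) := by
      rw [cluster_wallFlip]; exact he
    have h2 : wallFlip ends a₁ F (wallFlip ends a₁ F y) e = wallFlip ends a₁ F y e :=
      wallFlip_of_not ends a₁ F he'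
    rw [h2, h1]

/-- The wall flip preserves admissibility (agreement with the pinning off `F`). -/
lemma wallFlip_admissible_iff (z y : Config E) :
    (∀ e, e ∉ F → wallFlip ends a₁ F y e = z e) ↔ (∀ e, e ∉ F → y e = z e) := by
  constructor
  · intro h e he; rw [← wallFlip_of_notMem ends a₁ F (y := y) he]; exact h e he
  · intro h e he; rw [wallFlip_of_notMem ends a₁ F he]; exact h e he

/-- **The wall is a set of hubs for the second copy**: under `Q` (`a₁ ↮ a₂` in `y`), every vertex
of the red cluster of `a₂` in `y` lies in the cluster of `a₂` of the SECOND copy of the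
wall-flipped configuration — the open edges of `C_y(a₂)` do not touch `C_y(a₁)`, so they are
complemented twice. -/
lemma conn_flipOn_wallFlip {y : Config E} {a₂ o : V} (hQ : ¬ Conn ends y a₁ a₂)
    (h : Conn ends y a₂ o) : Conn ends (flipOn F (wallFlip ends a₁ F y)) a₂ o := by
  set w := flipOn F (wallFlip ends a₁ F y) with hw
  -- closure argument along the open path of `y` from `a₂` to `o`
  have key : o ∈ {u | Conn ends y a₂ u ∧ Conn ends w a₂ u} := by
    refine mem_of_conn_of_closed (ends := ends) (ω := y) ?_
      ⟨conn_refl ends y a₂, conn_refl ends w a₂⟩ h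
    rintro x ⟨hx, hxw⟩ u hxu
    obtain ⟨_, e, he, hends⟩ := openGraph_adj.1 hxu
    have hu : Conn ends y a₂ u := conn_trans hx (conn_of_openAdj ⟨e, he, hends⟩)
    refine ⟨hu, conn_trans hxw (conn_of_openAdj ⟨e, ?_, hends⟩)⟩
    -- `e` does not touch the cluster of `a₁`
    have hnot : e ∉ touches ends (cluster ends y a₁) := by
      rintro ⟨x', hx', y', hxy'⟩
      rw [hends, Sym2.eq_iff] at hxy'
      have hx'c : Conn ends y a₂ x' := by
        rcases hxy' with ⟨h1, _⟩ | ⟨_, h2⟩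
        · exact h1 ▸ hx
        · exact h2 ▸ hu
      exact hQ (conn_trans (mem_cluster.1 hx') (conn_symm hx'c))
    -- hence `w e = y e`
    have : w e = y e := by
      rw [hw]
      by_cases heF : e ∈ F
      · rw [flipOn_of_mem F _ heF, wallFlip_of_mem ends a₁ F heF hnot, Bool.not_not]
      · rw [flipOn_of_notMem F _ heF, wallFlip_of_notMem ends a₁ F heF]
    rw [this]; exact he
  exact key.2

end WallFlip

section IndicatorsOrd

variable {V : Type} {E : Type} {R : Type*} [Field R] [LinearOrder R] [IsStrictOrderedRing R]

/-- `1_{a₂ ↔ o}` is monotone along `Conn`. -/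
lemma iH_le_of_conn (ends : E → Sym2 V) (a₂ o : V) {y w : Config E}
    (h : Conn ends y a₂ o → Conn ends w a₂ o) : (iH ends a₂ o y : R) ≤ iH ends a₂ o w := by
  unfold iH
  by_cases hy : Conn ends y a₂ o
  · rw [Set.indicator_of_mem (by rw [mem_connEvent]; exact hy),
      Set.indicator_of_mem (by rw [mem_connEvent]; exact h hy)]
    exact le_rfl
  · rw [Set.indicator_of_notMem (by rw [mem_connEvent]; exact hy)]
    exact Set.indicator_nonneg (fun _ _ => zero_le_one) w

/-- `1_{b ∈ C(a₁)} ≥ 0`. -/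
lemma iL_nonneg' (ends : E → Sym2 V) (a₁ b : V) (y : Config E) : 0 ≤ (iL ends a₁ b y : R) :=
  Set.indicator_nonneg (fun _ _ => zero_le_one) y

end IndicatorsOrd

section IndicatorsFlip

variable {V : Type} {E : Type} [DecidableEq E] {R : Type*} [Field R]

/-- `1_Q` is fixed by the wall flip. -/
lemma iQ_wallFlip (ends : E → Sym2 V) (a₁ a₂ : V) (F : Finset E) (y : Config E) :
    (iQ ends a₁ a₂ (wallFlip ends a₁ F y) : R) = iQ ends a₁ a₂ y := by
  unfold iQ
  have hiff : wallFlip ends a₁ F y ∈ avoidAll ends a₂ {a₁} ↔ y ∈ avoidAll ends a₂ {a₁} := by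
    simp only [mem_avoidAll, Finset.mem_singleton, forall_eq]
    constructor
    · intro h hc; exact h (conn_symm ((conn_wallFlip_iff ends a₁ F y a₂).2 (conn_symm hc)))
    · intro h hc; exact h (conn_symm ((conn_wallFlip_iff ends a₁ F y a₂).1 (conn_symm hc)))
  by_cases hy : y ∈ avoidAll ends a₂ {a₁}
  · rw [Set.indicator_of_mem (hiff.2 hy), Set.indicator_of_mem hy]
    rfl
  · rw [Set.indicator_of_notMem (fun h => hy (hiff.1 h)), Set.indicator_of_notMem hy]

/-- `1_{b ∈ C(a₁)}` is fixed by the wall flip. -/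
lemma iL_wallFlip (ends : E → Sym2 V) (a₁ b : V) (F : Finset E) (y : Config E) :
    (iL ends a₁ b (wallFlip ends a₁ F y) : R) = iL ends a₁ b y := by
  unfold iL
  have hiff : wallFlip ends a₁ F y ∈ connEvent ends a₁ b ↔ y ∈ connEvent ends a₁ b := by
    simp only [mem_connEvent]
    exact conn_wallFlip_iff ends a₁ F y b
  by_cases hy : y ∈ connEvent ends a₁ b
  · rw [Set.indicator_of_mem (hiff.2 hy), Set.indicator_of_mem hy]
    rfl
  · rw [Set.indicator_of_notMem (fun h => hy (hiff.1 h)), Set.indicator_of_notMem hy]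

end IndicatorsFlip

section Half

variable {V : Type} {E : Type} [Fintype E] [DecidableEq E] {R : Type*} [Field R] [LinearOrder R]
  [IsStrictOrderedRing R]

/-- **The half-conditioned typed BHK 1.4** (THEOREM, unconditional): for every finite graph, every
profile (free set `F`, pinned configuration `z`), every roots `a₁, a₂` and vertices `b, o`,
`N(Q ∩ A ∩ B, Ω) ≤ N(Q ∩ A, B)` — the same-copy count of `Q ∩ {b ∈ C(a₁)} ∩ {o ∈ C(a₂)}` is at
most the cross-copy count with `{o ∈ C(a₂)}` moved to the second copy (which carries no `Q`). -/
theorem pairCount_half (ends : E → Sym2 V) (a₁ a₂ b o : V) (F : Finset E) (z : Config E) :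
    pairCount F z (fun y _ => iQ ends a₁ a₂ y * iL ends a₁ b y * iH ends a₂ o y :
        Config E → Config E → R) ≤
      pairCount F z (fun y w => iQ ends a₁ a₂ y * iL ends a₁ b y * iH ends a₂ o w) := by
  unfold pairCount
  beta_reduce
  have hinv : Function.Involutive (wallFlip ends a₁ F) := fun y => wallFlip_wallFlip ends a₁ F y
  calc
    ∑ y : Config E, (if (∀ e, e ∉ F → y e = z e) then
        (iQ ends a₁ a₂ y : R) * iL ends a₁ b y * iH ends a₂ o y else 0)
      ≤ ∑ y : Config E, (if (∀ e, e ∉ F → y e = z e) then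
        (iQ ends a₁ a₂ y : R) * iL ends a₁ b y * iH ends a₂ o (flipOn F (wallFlip ends a₁ F y))
        else 0) := by
      refine Finset.sum_le_sum fun y _ => ?_
      by_cases hadm : ∀ e, e ∉ F → y e = z e
      · rw [if_pos hadm, if_pos hadm]
        by_cases hQ : Conn ends y a₁ a₂
        · -- `1_Q(y) = 0`: both sides vanish
          have h0 : (iQ ends a₁ a₂ y : R) = 0 := by
            unfold iQ
            rw [Set.indicator_of_notMem]
            simp only [mem_avoidAll, Finset.mem_singleton, forall_eq, not_not]
            exact conn_symm hQ
          rw [h0]; simp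
        · exact mul_le_mul_of_nonneg_left
            (iH_le_of_conn ends a₂ o (conn_flipOn_wallFlip ends a₁ F hQ))
            (mul_nonneg (iQ_nonneg ends a₁ a₂ y) (iL_nonneg' ends a₁ b y))
      · rw [if_neg hadm, if_neg hadm]
    _ = ∑ y : Config E, (if (∀ e, e ∉ F → wallFlip ends a₁ F y e = z e) then
        (iQ ends a₁ a₂ (wallFlip ends a₁ F y) : R) * iL ends a₁ b (wallFlip ends a₁ F y) *
          iH ends a₂ o (flipOn F (wallFlip ends a₁ F y)) else 0) := by
      refine Finset.sum_congr rfl fun y _ => ?_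
      rw [iQ_wallFlip, iL_wallFlip]
      by_cases hadm : ∀ e, e ∉ F → y e = z e
      · rw [if_pos hadm, if_pos ((wallFlip_admissible_iff ends a₁ F z y).2 hadm)]
      · rw [if_neg hadm, if_neg (fun h => hadm ((wallFlip_admissible_iff ends a₁ F z y).1 h))]
    _ = ∑ y : Config E, (if (∀ e, e ∉ F → y e = z e) then
        (iQ ends a₁ a₂ y : R) * iL ends a₁ b y * iH ends a₂ o (flipOn F y) else 0) := by
      exact Fintype.sum_equiv hinv.toPerm _ _ (fun y => rfl)

/-- **Corollary in the `TB14` shape**: the same-copy count of `TB14`, `N(Q ∩ A ∩ B, Q)`, is at most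
the half-conditioned cross count `N(Q ∩ A, B)` (drop the second copy's `Q`: `1_Q ≤ 1`). The
candidate `TB14` asserts the sharper bound by `N(Q ∩ A, Q ∩ B)`; that bound is NOT proved here. -/
theorem pairCount_sameBO_le_half (ends : E → Sym2 V) (a₁ a₂ b o : V) (F : Finset E)
    (z : Config E) :
    pairCount F z (sameBO ends a₁ a₂ b o : Config E → Config E → R) ≤
      pairCount F z (fun y w => iQ ends a₁ a₂ y * iL ends a₁ b y * iH ends a₂ o w) := by
  refine le_trans ?_ (pairCount_half ends a₁ a₂ b o F z)
  unfold pairCount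
  beta_reduce
  refine Finset.sum_le_sum fun y _ => ?_
  by_cases hadm : ∀ e, e ∉ F → y e = z e
  · rw [if_pos hadm, if_pos hadm]
    unfold sameBO
    have h1 : (iQ ends a₁ a₂ (flipOn F y) : R) ≤ 1 := by
      unfold iQ
      exact Set.indicator_apply_le' (fun _ => le_rfl) (fun _ => zero_le_one)
    calc (iQ ends a₁ a₂ y : R) * iL ends a₁ b y * iH ends a₂ o y * iQ ends a₁ a₂ (flipOn F y)
        ≤ (iQ ends a₁ a₂ y : R) * iL ends a₁ b y * iH ends a₂ o y * 1 :=
          mul_le_mul_of_nonneg_left h1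
            (mul_nonneg (mul_nonneg (iQ_nonneg ends a₁ a₂ y) (iL_nonneg' ends a₁ b y))
              (Set.indicator_nonneg (fun _ _ => zero_le_one) y))
      _ = (iQ ends a₁ a₂ y : R) * iL ends a₁ b y * iH ends a₂ o y := mul_one _
  · rw [if_neg hadm, if_neg hadm]

end Half

end TypedBHKHalf

end Summit.Ventures.PercRepro2
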